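import Summits.HubbardSuperconductivity.HubbardSuperconductivity.Theorems.AnisotropyChordInsertionEntropyJastrowTeleBound

/-!
# Route `AnisotropyChord` / H0 rotor rung: TELEPORTATION DECONFINEMENT OF THE COULOMB-SHEET JASTROW FAMILY WITH A
# LINEAR CONSTANT, ALL TORUS SIZES (direct Onsager route of `…InsertionEntropyJastrowTeleBound`)

`coulombSheet_teleDeconfined_linear : 0 ≤ β → TeleDeconfined (coulombSheetFamily β) (L ↦ ⌊L²/2⌋)` with constant `150β`
(`|Λ|/(|Λ|−N) ≤ 3` on the half-filling window `2N ≤ |Λ| ≤ 3N`), and the even-size form with `100β`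
(`coulombSheet_teleDeconfinedAlong_linear`).  The tree's `coulombSheet_teleDeconfinedAlong` (sup-pair route) has the
doubly-exponential `resamplingConst (50β) (50β)`.
-/

set_option linter.dupNamespace false

noncomputable section

open Finset
open Literature.Probability.LatticeModels

namespace Summit.HubbardSuperconductivity.HubbardSuperconductivity.Theorems.AnisotropyChord.InsertionEntropy

section CoulombSheetLinearFamily

/-- The linear deconfinement bound for the Coulomb-sheet Jastrow state at fixed `L ≥ 2`:
`−150β ≤ T(ψ_{W_L(β), ⌊L²/2⌋})`. [folklore] -/
theorem meanTeleLog_coulombSheet_ge {β : ℝ} (hβ : 0 ≤ β) (L : ℕ) [NeZero L] (hL : 2 ≤ L) :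
    -(150 * β) ≤ meanTeleLog (jAmp (coulombSheetKernel L β) (L ^ 2 / 2)) ((L ^ 2 / 2 : ℕ) : ℝ) := by
  obtain ⟨h1, h2, h3⟩ := halfFilling_numerology L hL
  have hNV : L ^ 2 / 2 < Fintype.card (TorusSite 2 L) := by omega
  have h := meanTeleLog_jAmp_ge_of_psd_linear (coulombSheetKernel L β) (coulombSheetKernel_neg β)
    (coulombSheetKernel_zero β) (coulombSheetKernel_nonneg hβ) (L ^ 2 / 2) (by omega) hNV (by positivity)
    (coulombSheetKernel_psd hβ)
  refine le_trans ?_ h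
  -- |Λ|/(|Λ|−N) ≤ 3 on the window N ≥ 2, 2N ≤ |Λ| ≤ 3N
  have hV : ((Fintype.card (TorusSite 2 L) : ℕ) : ℝ) ≤ 3 * ((L ^ 2 / 2 : ℕ) : ℝ) := by exact_mod_cast h3
  have hVN : (2 : ℝ) * ((L ^ 2 / 2 : ℕ) : ℝ) ≤ ((Fintype.card (TorusSite 2 L) : ℕ) : ℝ) := by exact_mod_cast h2
  have hN2 : (2 : ℝ) ≤ ((L ^ 2 / 2 : ℕ) : ℝ) := by exact_mod_cast h1
  have hden : 0 < ((Fintype.card (TorusSite 2 L) : ℕ) : ℝ) - ((L ^ 2 / 2 : ℕ) : ℝ) := by linarith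
  have hratio : ((Fintype.card (TorusSite 2 L) : ℕ) : ℝ) / (((Fintype.card (TorusSite 2 L) : ℕ) : ℝ)
      - ((L ^ 2 / 2 : ℕ) : ℝ)) ≤ 3 := by
    rw [div_le_iff₀ hden]; linarith
  have h50 : 0 ≤ 50 * β := by positivity
  nlinarith [mul_le_mul_of_nonneg_right hratio h50]

/-- **`TeleDeconfined` for the whole Coulomb-sheet family with the LINEAR constant `150β`** (every `L ≥ 2`, every
`β ≥ 0`). [folklore] -/
theorem coulombSheet_teleDeconfined_linear {β : ℝ} (hβ : 0 ≤ β) :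
    TeleDeconfined (coulombSheetFamily β) (fun L => ((L ^ 2 / 2 : ℕ) : ℝ)) := by
  refine ⟨150 * β, fun L _ hL => ?_⟩
  rw [coulombSheetFamily_eq]
  exact meanTeleLog_coulombSheet_ge hβ L hL

/-- The sub-family form (`TeleDeconfinedAlong P` for every `P`, in particular `Even`) with the same linear constant.
[folklore] -/
theorem coulombSheet_teleDeconfinedAlong_linear {β : ℝ} (hβ : 0 ≤ β) (P : ℕ → Prop) :
    TeleDeconfinedAlong P (coulombSheetFamily β) (fun L => ((L ^ 2 / 2 : ℕ) : ℝ)) :=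
  teleDeconfinedAlong_of_teleDeconfined P _ _ (coulombSheet_teleDeconfined_linear hβ)

end CoulombSheetLinearFamily

end Summit.HubbardSuperconductivity.HubbardSuperconductivity.Theorems.AnisotropyChord.InsertionEntropy
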